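import Literature.IUT.LogVolume.TensorPacketSlotUnion
import Literature.IUT.LogVolume.TensorPacketHullVolume
import Literature.IUT.LogVolume.TensorPacketModel
import HarnessLib

/-!
# [IUTchIV] Thm. 1.10 Steps (v)–(vi), PER SUMMAND, in the REAL tensor-packet model: the `v⃗`-component of
# `hull(U_Θ)` and its log-volume against the bare Θ-region (`λ_min` form)

Mochizuki, *Inter-universal Teichmüller theory IV* (RIMS ms Apr. 2020 = PRIMS **57** (2021)), proof of
Thm. 1.10, Step (v), p. 27–28 ("the inclusion "`φ(p^λ·(R_I)^∼) ⊆ p^{⌊λ−d_I−a_I⌋}·log_p(R_I^×)`" … implies that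
[a module] contains the "union of possible images of a Θ-pilot object" … (Ind1) and (Ind2) are taken into
account by the arbitrary nature of the automorphism "`φ`" … while (Ind3) is taken into account by the fact
that we are considering upper bounds … an upper bound on the component of the log-volume of the holomorphic
hull … may be obtained by computing an upper bound for the log-volume of … "`p^{⌊λ−d_I−a_I⌋−b_I}·(R_I)^∼`""),
Step (vi), p. 29. Dupuy–Hilado, arXiv:2004.13228, §3.9 (`O_𝕃(−P_Θ)`: twist by `t_{j,v_j}` through the LAST
factor), §4.7 ((Ind1) = factor permutations between the summands `v⃗ ∘ σ` and `v⃗`), §4.9 ((Ind2) =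
`Aut_{ℚ_p}(K_{v⃗} : I_{v⃗})`), §4.10–4.12 ((Ind3) as an enlargement, `U_Θ`, hull).

THEOREMS ONLY (abc-iut cell, WAVE-3 discharge seat abc-iut-c312-d1; plan/D9PRIME-OBLIGATIONS.md rows O2/O3),
over abc-iut-c312-3's REAL model (`TensorPacketModel.lean`: `realPrimePacket p 𝔽` — `X_{v⃗} = ⊗_{ℚ_p} K_{v̲_i}`,
`O = (R_I)^∼`, `log μ̄ = packetLogμ`, peel `= ι_j(a)·`, `perm σ = permAlgEquiv σ`, `G₂ = indTwo ⊆` the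
`log_p(R_I^×)`-automorphisms, `hullLoc = packetHull`), this file's own `TensorPacketSlotUnion.lean` (the
(Ind1)-slot-union container at `λ_min`) and abc-iut-S2's `TensorPacketHullVolume.lean` (volumes at `packetLogμ`):
* `permAlgEquiv_iota`, `image_permAlgEquiv_iota_smul_normalizedPacket` — the (Ind1)-transport of the bare
  region of the permuted summand `v⃗ ∘ σ` IS the twist of `(R_I)^∼` by the SAME scalar at the slot `σ(j)` of `v⃗`
  (the kernel form of STEPV-IND1-NOTE §2: ranging over (Ind1), the `v⃗`-component receives every slot's value);
* `indTwo_smul_subset_autImages`, `indTwo_smul_autImages_subset` — (Ind2)-images stay inside the union of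
  possible images `autImages`;
* `localUnion_subset_slotUnion` — hence the whole local (Ind2)·(Ind1)-orbit of (Ind3)-data `B_σ ⊆
  t_{σ(j)}·(R_I)^∼` (the SHARP reading of (Ind3): no enlargement beyond the bare regions — plan/D9PRIME O4) lies
  in the slot-union `⋃_i autImages(ι_i(t_{v_i})·(R_I)^∼)`;
* `realPrimePacket_stepV` — **the per-summand Step (v) bound in the real packet**: the hull of that orbit is
  admissible and `log μ̄(hull) − log μ̄(t_{v_j}·(R_I)^∼) ≤ {log‖t_{v_{i₀}}‖ − log‖t_{v_j}‖} + {d_I + 1}·log(p) +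
  Σ_{i∈I*}{3 + log(e_i)}` for a slot `i₀` of LARGEST norm (least order `λ_min`; `= {λ_j − λ_min + d_I + 1}·log(p)
  + Σ…`) — modulo [IUTchIV] Prop. 1.2 (ii) as the hypothesis `Prop12ii` (proved by the Prop. 1.1/1.2 companions);
* `realPrimePacket_stepVI` — Step (vi): unit slot values, `p > 2`, all `e_i = 1` (`Prop12iv`) ⇒ `log μ̄(hull) ≤ 0`;
The orbit `⋃_{g,σ} g·perm_σ(B_{v⃗∘σ})` is, verbatim, abc-iut-c312-3's `PrimePacket.localUTheta B j v⃗` (and its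
`packetHull` the `localHull`), to which `IndPacketModel.hullUTheta_eq_localHull` reduces the `v⃗`-component of
`hull(U_Θ)` of a model; so these are the per-summand inputs `h` of `DHData.estimateDH_of_componentBounds` for
`DHData.ofTensor` (summit-side glue).
[cite: Mochizuki2012, IUTchIV Thm 1.10 proof Step (v) p.27–28, Step (vi) p.29] [cite: DupuyHilado2025, §3.9, §4.7, §4.9, §4.11, §4.12]
HONEST SCOPE: the sharp reading of (Ind3) and the identification of the Θ-pilot's possible images with this
orbit are HYPOTHESES/INPUTS of the model, not assertions about [IUTchIII] Thm. 3.11 / Cor. 3.12; no side taken.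
-/

noncomputable section

open Set MeasureTheory NumberField IsDedekindDomain
open scoped Pointwise TensorProduct

namespace Literature.IUT.LogVolume

/-! ## Packet-level glue: (Ind1) on a slot twist, (Ind2) inside the possible images -/

section Packet

variable (p : ℕ) [Fact p.Prime]
variable {I : Type} [Fintype I] [DecidableEq I]
variable (s : I → Type) [∀ i, NontriviallyNormedField (s i)] [∀ i, NormedAlgebra ℚ_[p] (s i)]
  [∀ i, IsUltrametricDist (s i)] [∀ i, ProperSpace (s i)]

omit [Fintype I] [∀ i, IsUltrametricDist (s i)] [∀ i, ProperSpace (s i)] in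
/-- **(Ind1) on a slot scalar**: the factor permutation carries `ι_a(x)` of the packet `⊗_c s_{σ(c)}` to
`ι_{σ(a)}(x)` of `⊗_b s_b` ("`x_0 ⊗ ⋯ ⊗ x_j ↦ x_{f^{−1}(0)} ⊗ ⋯`"). [cite: DupuyHilado2025, §4.7] -/
theorem permAlgEquiv_iota (σ : Equiv.Perm I) (a : I) (x : s (σ a)) :
    permAlgEquiv p s σ (iota p (fun c => s (σ c)) a x) = iota p s (σ a) x := by
  rw [iota_eq_purePacket, permAlgEquiv_purePacket, iota_eq_purePacket]
  congr 1
  funext b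
  obtain ⟨c, rfl⟩ := σ.surjective b
  rw [Equiv.piCongrLeft_apply_apply]
  by_cases h : c = a
  · subst h
    rw [Pi.mulSingle_eq_same, Pi.mulSingle_eq_same]
  · rw [Pi.mulSingle_eq_of_ne h, Pi.mulSingle_eq_of_ne (σ.injective.ne h)]

omit [Fintype I] [DecidableEq I] [∀ i, IsUltrametricDist (s i)] [∀ i, ProperSpace (s i)] in
/-- An algebra isomorphism maps a multiplicative translate to the translate of the image:
`f(c·A) = f(c)·f(A)`. [folklore] -/
private theorem image_smul_set_algEquiv {V W : Type} [CommRing V] [CommRing W] [Algebra ℚ_[p] V]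
    [Algebra ℚ_[p] W] (f : V ≃ₐ[ℚ_[p]] W) (c : V) (A : Set V) : f '' (c • A) = f c • f '' A := by
  rw [← image_smul, ← image_smul, image_image, image_image]
  exact image_congr fun a _ => by rw [smul_eq_mul, smul_eq_mul, map_mul]

omit [DecidableEq I] in
/-- **The (Ind1)-transport of a bare region**: `perm_σ(ι_a(x)·(R_I)^∼_{v⃗∘σ}) = ι_{σ(a)}(x)·(R_I)^∼_{v⃗}` — the
transported twist sits at the slot `σ(a)` of the target summand, with the SAME scalar (STEPV-IND1-NOTE §2).
[cite: DupuyHilado2025, §4.7] -/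
theorem image_permAlgEquiv_iota_smul_normalizedPacket [DecidableEq I] [Nonempty I] (σ : Equiv.Perm I)
    (a : I) (x : s (σ a)) :
    permAlgEquiv p s σ '' (iota p (fun c => s (σ c)) a x •
        (normalizedPacket p (fun c => s (σ c)) : Set (PacketAlgebra p (fun c => s (σ c))))) =
      iota p s (σ a) x • (normalizedPacket p s : Set (PacketAlgebra p s)) := by
  rw [image_smul_set_algEquiv, permAlgEquiv_iota, image_normalizedPacket_perm]

omit [Fintype I] [DecidableEq I] [∀ i, IsUltrametricDist (s i)] [∀ i, ProperSpace (s i)] in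
/-- Composites of `log_p(R_I^×)`-automorphisms are `log_p(R_I^×)`-automorphisms. [cite: Mochizuki2012, IUTchIV Prop. 1.2 p. 10] -/
theorem isLogPacketAut_trans {φ φ' : PacketAlgebra p s ≃ₗ[ℚ_[p]] PacketAlgebra p s}
    (hφ : IsLogPacketAut p s φ) (hφ' : IsLogPacketAut p s φ') : IsLogPacketAut p s (φ.trans φ') := by
  unfold IsLogPacketAut at *
  have : ((φ.trans φ' : PacketAlgebra p s ≃ₗ[ℚ_[p]] PacketAlgebra p s) : PacketAlgebra p s → PacketAlgebra p s) =
      (φ' : PacketAlgebra p s → PacketAlgebra p s) ∘ (φ : PacketAlgebra p s → PacketAlgebra p s) := rfl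
  rw [this, Set.image_comp, hφ, hφ']

omit [Fintype I] [DecidableEq I] [∀ i, IsUltrametricDist (s i)] [∀ i, ProperSpace (s i)] in
/-- The union of possible images is stable under every `log_p(R_I^×)`-automorphism.
[cite: Mochizuki2012, IUTchIV Thm 1.10 proof Step (v) p.27] -/
theorem image_autImages_subset {φ : PacketAlgebra p s ≃ₗ[ℚ_[p]] PacketAlgebra p s}
    (hφ : IsLogPacketAut p s φ) (A : Set (PacketAlgebra p s)) :
    (φ : PacketAlgebra p s → PacketAlgebra p s) '' autImages p s A ⊆ autImages p s A := by
  rintro _ ⟨y, hy, rfl⟩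
  obtain ⟨φ₀, hφ₀, z, hz, rfl⟩ := (mem_autImages_iff p s).mp hy
  exact (mem_autImages_iff p s).mpr ⟨φ₀.trans φ, isLogPacketAut_trans p s hφ₀ hφ, z, hz, rfl⟩

omit [Fintype I] [DecidableEq I] [∀ i, IsUltrametricDist (s i)] [∀ i, ProperSpace (s i)] in
/-- **(Ind2) inside the possible images**: `g·A ⊆ autImages(A)` for `g ∈ Aut_{ℚ_p}(V : log_p(R_I^×))`.
[cite: DupuyHilado2025, §4.9] -/
theorem indTwo_smul_subset_autImages (g : indTwo p s) (A : Set (PacketAlgebra p s)) :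
    g • A ⊆ autImages p s A := by
  rw [indTwo_smul_set]
  exact image_subset_autImages p s (isLogPacketAut_of_mem p s g.2)

omit [Fintype I] [DecidableEq I] [∀ i, IsUltrametricDist (s i)] [∀ i, ProperSpace (s i)] in
/-- … and `g·autImages(A) ⊆ autImages(A)`. [cite: DupuyHilado2025, §4.9] -/
theorem indTwo_smul_autImages_subset (g : indTwo p s) (A : Set (PacketAlgebra p s)) :
    g • autImages p s A ⊆ autImages p s A := by
  rw [indTwo_smul_set]
  exact image_autImages_subset p s (isLogPacketAut_of_mem p s g.2) A

omit [Fintype I] [DecidableEq I] in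
/-- Least order is largest norm: from `‖g_i‖ = p^{−m_i/e_i}` and `‖g_i‖ ≤ ‖g_{i₀}‖`,
`m_{i₀}/e_{i₀} ≤ m_i/e_i`. [cite: Mochizuki2012, IUTchIV Thm 1.10 proof Step (v) p.27] -/
theorem slotOrder_le_of_norm_le {i i₀ : I} {m m₀ : ℤ} {g : s i} {g₀ : s i₀}
    (hg : ‖g‖ = (p : ℝ) ^ (-((m : ℝ) / absRamificationIdx p (s i))))
    (hg₀ : ‖g₀‖ = (p : ℝ) ^ (-((m₀ : ℝ) / absRamificationIdx p (s i₀)))) (hle : ‖g‖ ≤ ‖g₀‖) :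
    (m₀ : ℝ) / absRamificationIdx p (s i₀) ≤ (m : ℝ) / absRamificationIdx p (s i) := by
  have hp1 : (1 : ℝ) < p := by exact_mod_cast (Fact.out : p.Prime).one_lt
  rw [hg, hg₀, Real.rpow_le_rpow_left_iff hp1] at hle
  linarith

end Packet

/-! ## The real prime packet: the local (Ind2)·(Ind1)-orbit of sharp (Ind3)-data and its hull -/

section RealPacket

variable {F : Type} [Field F] [NumberField F]
variable (p : ℕ) [Fact p.Prime] (𝔽 : LocalFields F p)

/-- **The (Ind1)-transport of the bare region of a permuted summand**: in the real packet,
`perm_σ(t·O_{v⃗∘σ}) = ι_{σ(j)}(t)·(R_I)^∼_{v⃗}` for the scalar `t ∈ (fun i => 𝔽.k (e i))^×_{v̲_{σ(j)}}` read at the LAST place of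
`v⃗ ∘ σ` (Dupuy–Hilado §3.9 twists through the last factor; §4.7 moves the factors).
[cite: DupuyHilado2025, §3.9, §4.7] -/
theorem realPrimePacket_perm_image_bare {j : ℕ} (σ : Equiv.Perm (Fin (j + 1)))
    (e : Fin (j + 1) → placesOver F p) (t : (𝔽.k (e (σ (Fin.last j))))ˣ) :
    (realPrimePacket p 𝔽).perm σ e ''
        ((realPrimePacket p 𝔽).peel t '' (realPrimePacket p 𝔽).O j (e ∘ σ)) =
      iota p (fun i => 𝔽.k (e i)) (σ (Fin.last j)) (t : 𝔽.k (e (σ (Fin.last j)))) •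
        (normalizedPacket p (fun i => 𝔽.k (e i)) : Set (PacketAlgebra p (fun i => 𝔽.k (e i)))) := by
  rw [realPrimePacket_peel_image, realPrimePacket_O]
  exact image_permAlgEquiv_iota_smul_normalizedPacket p (fun i => 𝔽.k (e i)) σ (Fin.last j) (t : _)

/-- **The local orbit lies in the slot-union.** In the real packet, for theta values `t_v ∈ (fun i => 𝔽.k (e i))^×_{v̲}` at the
places over `p` and (Ind3)-data `B_σ ⊆ t_{v_{σ(j)}}·O_{v⃗∘σ}` on the permuted summands (the SHARP reading of
(Ind3)), every `g·perm_σ(B_σ)` (`g` in the (Ind2)-group of `v⃗`) lies in `⋃_i autImages(ι_i(t_{v_i})·(R_I)^∼)`.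
[cite: DupuyHilado2025, §4.7, §4.9, §4.11] -/
theorem realPrimePacket_localUnion_subset_slotUnion {j : ℕ} (e : Fin (j + 1) → placesOver F p)
    (t : ∀ v : placesOver F p, (𝔽.k v)ˣ)
    (B : (realPrimePacket p 𝔽).Region)
    (hB : ∀ σ : Equiv.Perm (Fin (j + 1)),
      B j (e ∘ σ) ⊆ (realPrimePacket p 𝔽).peel (t (e (σ (Fin.last j)))) '' (realPrimePacket p 𝔽).O j (e ∘ σ)) :
    (⋃ (g : (realPrimePacket p 𝔽).G₂ j e) (σ : Equiv.Perm (Fin (j + 1))),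
        g • ((realPrimePacket p 𝔽).perm σ e '' B j (e ∘ σ))) ⊆
      ⋃ i, autImages p (fun i => 𝔽.k (e i))
        (iota p (fun i => 𝔽.k (e i)) i (t (e i) : 𝔽.k (e i)) •
          (normalizedPacket p (fun i => 𝔽.k (e i)) : Set (PacketAlgebra p (fun i => 𝔽.k (e i))))) := by
  refine Set.iUnion₂_subset fun g σ => ?_
  have h1 : (realPrimePacket p 𝔽).perm σ e '' B j (e ∘ σ) ⊆
      iota p (fun i => 𝔽.k (e i)) (σ (Fin.last j)) (t (e (σ (Fin.last j))) : _) •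
        (normalizedPacket p (fun i => 𝔽.k (e i)) : Set (PacketAlgebra p (fun i => 𝔽.k (e i)))) := by
    rw [← realPrimePacket_perm_image_bare p 𝔽 σ e (t (e (σ (Fin.last j))))]
    exact Set.image_mono (hB σ)
  refine (Set.smul_set_mono h1).trans ((indTwo_smul_subset_autImages p _ g _).trans ?_)
  exact Set.subset_iUnion (fun i => autImages p (fun i => 𝔽.k (e i))
    (iota p (fun i => 𝔽.k (e i)) i (t (e i) : 𝔽.k (e i)) •
      (normalizedPacket p (fun i => 𝔽.k (e i)) : Set (PacketAlgebra p (fun i => 𝔽.k (e i)))))) (σ (Fin.last j))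

/-- **Step (v) per summand, in the real packet.** Degree `j ≥ 1`, summand `v⃗ = (v_0,…,v_j)`, theta values
`t_v ∈ (fun i => 𝔽.k (e i))^×_{v̲}`, SHARP (Ind3)-data `B_σ ⊆ t_{v_{σ(j)}}·O_{v⃗∘σ}` with `t_{v_j}·O_{v⃗} ⊆ B_1`, [IUTchIV] Prop. 1.2 (ii)
for the packet (`Prop12ii`), `I* ⊆` the slots off which `e_i ≤ p − 2`, and a slot `i₀` of largest norm
`‖t_{v_{i₀}}‖` (least order `λ_min`). Then the hull of the local (Ind2)·(Ind1)-orbit `U` of the data is admissible and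
`log μ̄(hull U) − log μ̄(t_{v_j}·O_{v⃗}) ≤ {log‖t_{v_{i₀}}‖ − log‖t_{v_j}‖} + {d_I + 1}·log(p) + Σ_{i∈I*}{3 + log(e_i)}`
— i.e. `{λ_j − λ_min + d_I + 1}·log(p) + Σ_{i∈I*}{3 + log(e_i)}`, the text's `{d_I + 1}·log(p) + Σ…` plus the
(Ind1)-slot term (zero for slot-constant orders). [cite: Mochizuki2012, IUTchIV Thm 1.10 proof Step (v) p.27–28] -/
theorem realPrimePacket_stepV {j : ℕ} (hj : 1 ≤ j) (e : Fin (j + 1) → placesOver F p)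
    (h12 : Prop12ii p (fun i => 𝔽.k (e i)))
    (t : ∀ v : placesOver F p, (𝔽.k v)ˣ)
    (B : (realPrimePacket p 𝔽).Region)
    (hB : ∀ σ : Equiv.Perm (Fin (j + 1)),
      B j (e ∘ σ) ⊆ (realPrimePacket p 𝔽).peel (t (e (σ (Fin.last j)))) '' (realPrimePacket p 𝔽).O j (e ∘ σ))
    (hB1 : (realPrimePacket p 𝔽).peel (t (e (Fin.last j))) '' (realPrimePacket p 𝔽).O j e ⊆ B j e)
    (Istar : Finset (Fin (j + 1)))
    (htame : ∀ i, i ∉ Istar → absRamificationIdx p (𝔽.k (e i)) ≤ p - 2)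
    (i₀ : Fin (j + 1)) (hmax : ∀ i, ‖(t (e i) : 𝔽.k (e i))‖ ≤ ‖(t (e i₀) : 𝔽.k (e i₀))‖) :
    PacketAdm p (fun i => 𝔽.k (e i)) (packetHull p (fun i => 𝔽.k (e i))
        (⋃ (g : (realPrimePacket p 𝔽).G₂ j e) (σ : Equiv.Perm (Fin (j + 1))),
          g • ((realPrimePacket p 𝔽).perm σ e '' B j (e ∘ σ)))) ∧
      packetLogμ p (fun i => 𝔽.k (e i)) (packetHull p (fun i => 𝔽.k (e i))
            (⋃ (g : (realPrimePacket p 𝔽).G₂ j e) (σ : Equiv.Perm (Fin (j + 1))),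
              g • ((realPrimePacket p 𝔽).perm σ e '' B j (e ∘ σ))))
          - packetLogμ p (fun i => 𝔽.k (e i))
              ((realPrimePacket p 𝔽).peel (t (e (Fin.last j))) '' (realPrimePacket p 𝔽).O j e)
        ≤ (Real.log ‖(t (e i₀) : 𝔽.k (e i₀))‖ - Real.log ‖(t (e (Fin.last j)) : 𝔽.k (e (Fin.last j)))‖)
            + (dSum p (fun i => 𝔽.k (e i)) + 1) * Real.log p
            + ∑ i ∈ Istar, (3 + Real.log (absRamificationIdx p (𝔽.k (e i)))) := by
  set U : Set (PacketAlgebra p (fun i => 𝔽.k (e i))) :=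
    ⋃ (g : (realPrimePacket p 𝔽).G₂ j e) (σ : Equiv.Perm (Fin (j + 1))),
      g • ((realPrimePacket p 𝔽).perm σ e '' B j (e ∘ σ)) with hU
  have hI : 2 ≤ Fintype.card (Fin (j + 1)) := by rw [Fintype.card_fin]; omega
  haveI : Nonempty (Fin (j + 1)) := ⟨0⟩
  -- slot data: orders `m_i` with `‖t_{v_i}‖ = p^{−m_i/e_i}`
  have ht0 : ∀ i, (t (e i) : (fun i => 𝔽.k (e i)) i) ≠ 0 := fun i => (t (e i)).ne_zero
  choose m hm using fun i => exists_norm_eq_rpow p ((fun i => 𝔽.k (e i)) i) (ht0 i)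
  have hmin : ∀ i, (m i₀ : ℝ) / absRamificationIdx p ((fun i => 𝔽.k (e i)) i₀) ≤ (m i : ℝ) / absRamificationIdx p ((fun i => 𝔽.k (e i)) i) :=
    fun i => slotOrder_le_of_norm_le p (fun i => 𝔽.k (e i)) (hm i) (hm i₀) (hmax i)
  obtain ⟨h, hh⟩ := exists_realizesNegB p (fun i => 𝔽.k (e i))
  -- the orbit lies in the slot-union, the bare region of `v⃗` lies in the orbit
  have hUu : U ⊆ ⋃ i, autImages p (fun i => 𝔽.k (e i)) (iota p (fun i => 𝔽.k (e i)) i (t (e i) : (fun i => 𝔽.k (e i)) i) • (normalizedPacket p (fun i => 𝔽.k (e i)) : Set (PacketAlgebra p (fun i => 𝔽.k (e i))))) :=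
    realPrimePacket_localUnion_subset_slotUnion p 𝔽 e t B hB
  have hbare : (realPrimePacket p 𝔽).peel (t (e (Fin.last j))) '' (realPrimePacket p 𝔽).O j e =
      iota p (fun i => 𝔽.k (e i)) (Fin.last j) (t (e (Fin.last j)) : (fun i => 𝔽.k (e i)) (Fin.last j)) • (normalizedPacket p (fun i => 𝔽.k (e i)) : Set (PacketAlgebra p (fun i => 𝔽.k (e i)))) := by
    rw [realPrimePacket_peel_image, realPrimePacket_O]
  have hUl : iota p (fun i => 𝔽.k (e i)) (Fin.last j) (t (e (Fin.last j)) : (fun i => 𝔽.k (e i)) (Fin.last j)) •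
      (normalizedPacket p (fun i => 𝔽.k (e i)) : Set (PacketAlgebra p (fun i => 𝔽.k (e i)))) ⊆ U := by
    rw [← hbare]
    refine hB1.trans ?_
    have : B j e ⊆ (1 : (realPrimePacket p 𝔽).G₂ j e) • ((realPrimePacket p 𝔽).perm 1 e '' B j (e ∘ (1 : Equiv.Perm (Fin (j + 1))))) := by
      rw [one_smul]
      intro x hx
      exact ⟨x, hx, (realPrimePacket p 𝔽).perm_one e x⟩
    exact this.trans (Set.subset_iUnion₂ (s := fun (g : (realPrimePacket p 𝔽).G₂ j e)
      (σ : Equiv.Perm (Fin (j + 1))) => g • ((realPrimePacket p 𝔽).perm σ e '' B j (e ∘ σ))) 1 1)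
  -- the hull lies in the least slot's translate; admissibility and volume from S2's hull-volume lemmas
  have hUC := packetHull_subset_translate_of_subset_iUnion_autImages_slot h12 hI m
    (fun i => (t (e i) : (fun i => 𝔽.k (e i)) i)) hm h hh i₀ hmin hUu
  have hne := dEquiv_ppow_mul_purePacket_ne_zero p (fun i => 𝔽.k (e i))
    ⌊(m i₀ : ℝ) / absRamificationIdx p ((fun i => 𝔽.k (e i)) i₀) - dSum p (fun i => 𝔽.k (e i)) - aSum p (fun i => 𝔽.k (e i))⌋ (ne_zero_of_realizesNegB p (fun i => 𝔽.k (e i)) hh)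
  have hA : PacketAdm p (fun i => 𝔽.k (e i)) (iota p (fun i => 𝔽.k (e i)) (Fin.last j) (t (e (Fin.last j)) : (fun i => 𝔽.k (e i)) (Fin.last j)) •
      (normalizedPacket p (fun i => 𝔽.k (e i)) : Set (PacketAlgebra p (fun i => 𝔽.k (e i))))) :=
    packetAdm_iota_smul p (fun i => 𝔽.k (e i)) (Fin.last j) (ht0 _) (packetAdm_normalizedPacket p (fun i => 𝔽.k (e i)))
  have hHsub : packetHull p (fun i => 𝔽.k (e i)) U ⊆ _ := hUC
  refine ⟨packetAdm_of_subset_of_subset p (fun i => 𝔽.k (e i)) hA (packetAdm_smul_normalizedPacket p (fun i => 𝔽.k (e i)) _ hne)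
    (hUl.trans (subset_packetHull p (fun i => 𝔽.k (e i)) U)) hHsub, ?_⟩
  have hvol : packetLogμ p (fun i => 𝔽.k (e i)) (packetHull p (fun i => 𝔽.k (e i)) U) ≤
      (-((m i₀ : ℝ) / absRamificationIdx p ((fun i => 𝔽.k (e i)) i₀)) + dSum p (fun i => 𝔽.k (e i)) + 1) * Real.log p
        + ∑ i ∈ Istar, (3 + Real.log (absRamificationIdx p ((fun i => 𝔽.k (e i)) i))) :=
    (packetLogμ_mono p (fun i => 𝔽.k (e i))
        (packetAdm_of_subset_of_subset p (fun i => 𝔽.k (e i)) hA (packetAdm_smul_normalizedPacket p (fun i => 𝔽.k (e i)) _ hne)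
          (hUl.trans (subset_packetHull p (fun i => 𝔽.k (e i)) U)) hHsub)
        (packetAdm_smul_normalizedPacket p (fun i => 𝔽.k (e i)) _ hne) hHsub).trans
      (Prop14iii₂_holds p (fun i => 𝔽.k (e i)) (DFac p (fun i => 𝔽.k (e i))) (dEquiv p (fun i => 𝔽.k (e i))) hI Istar htame i₀ (m i₀) h hh)
  have hq : packetLogμ p (fun i => 𝔽.k (e i))
      ((realPrimePacket p 𝔽).peel (t (e (Fin.last j))) '' (realPrimePacket p 𝔽).O j e) =
      Real.log ‖(t (e (Fin.last j)) : 𝔽.k (e (Fin.last j)))‖ := by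
    have := packetLogμ_iota_smul_normalizedPacket p (fun i => 𝔽.k (e i)) (Fin.last j) (ht0 (Fin.last j))
    rw [← hbare] at this
    exact this
  rw [hq]
  have hl0 := (slot_ne_zero_and_log_norm p (fun i => 𝔽.k (e i)) (hm i₀)).2
  dsimp only at hvol hl0
  rw [hl0]
  linarith

/-- **Step (vi) per summand, in the real packet**: if every theta value over `p` is a UNIT, `p > 2`, every
`(fun i => 𝔽.k (e i))_{v̲_i}/ℚ_p` is unramified (so [IUTchIV] Prop. 1.2 (iv), hypothesis `Prop12iv`) and the (Ind3)-data of the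
permuted summands lie in `O` ("bare3 ⊆ O there"), then the hull of the local orbit has `log μ̄ ≤ 0
= log μ̄(O_{v⃗})`: the per-summand discrepancy VANISHES off the distinguished primes.
[cite: Mochizuki2012, IUTchIV Thm 1.10 proof Step (vi) p.29] -/
theorem realPrimePacket_stepVI {j : ℕ} (hj : 1 ≤ j) (e : Fin (j + 1) → placesOver F p) (hp : 2 < p)
    (h4 : Prop12iv p (fun i => 𝔽.k (e i))) (he : ∀ i, absRamificationIdx p (𝔽.k (e i)) = 1)
    (B : (realPrimePacket p 𝔽).Region)
    (hB : ∀ σ : Equiv.Perm (Fin (j + 1)), B j (e ∘ σ) ⊆ (realPrimePacket p 𝔽).O j (e ∘ σ))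
    (hB1 : (realPrimePacket p 𝔽).O j e ⊆ B j e) :
    PacketAdm p (fun i => 𝔽.k (e i)) (packetHull p (fun i => 𝔽.k (e i))
        (⋃ (g : (realPrimePacket p 𝔽).G₂ j e) (σ : Equiv.Perm (Fin (j + 1))),
          g • ((realPrimePacket p 𝔽).perm σ e '' B j (e ∘ σ)))) ∧
      packetLogμ p (fun i => 𝔽.k (e i)) (packetHull p (fun i => 𝔽.k (e i))
        (⋃ (g : (realPrimePacket p 𝔽).G₂ j e) (σ : Equiv.Perm (Fin (j + 1))),
          g • ((realPrimePacket p 𝔽).perm σ e '' B j (e ∘ σ)))) ≤ 0 := by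
  set U : Set (PacketAlgebra p (fun i => 𝔽.k (e i))) :=
    ⋃ (g : (realPrimePacket p 𝔽).G₂ j e) (σ : Equiv.Perm (Fin (j + 1))),
      g • ((realPrimePacket p 𝔽).perm σ e '' B j (e ∘ σ)) with hU
  have hI : 2 ≤ Fintype.card (Fin (j + 1)) := by rw [Fintype.card_fin]; omega
  haveI : Nonempty (Fin (j + 1)) := ⟨0⟩
  -- every piece of the orbit is a possible image of a subset of `(R_I)^∼`
  have hUu : U ⊆ ⋃ σ : Equiv.Perm (Fin (j + 1)), autImages p (fun i => 𝔽.k (e i))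
      ((realPrimePacket p 𝔽).perm σ e '' B j (e ∘ σ)) := by
    refine Set.iUnion₂_subset fun g σ => (indTwo_smul_subset_autImages p (fun i => 𝔽.k (e i)) g _).trans ?_
    exact Set.subset_iUnion (fun σ' : Equiv.Perm (Fin (j + 1)) =>
      autImages p (fun i => 𝔽.k (e i)) ((realPrimePacket p 𝔽).perm σ' e '' B j (e ∘ σ'))) σ
  have hBO : ∀ σ : Equiv.Perm (Fin (j + 1)), (realPrimePacket p 𝔽).perm σ e '' B j (e ∘ σ) ⊆
      (normalizedPacket p (fun i => 𝔽.k (e i)) : Set (PacketAlgebra p (fun i => 𝔽.k (e i)))) := by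
    intro σ
    refine (Set.image_mono (hB σ)).trans ?_
    rw [realPrimePacket_O]
    exact (image_normalizedPacket_perm p (fun i => 𝔽.k (e i)) σ).subset
  have hH := packetHull_iUnion_autImages_subset_normalizedPacket h4 hI hp he _ hBO
  have hUl : (normalizedPacket p (fun i => 𝔽.k (e i)) : Set (PacketAlgebra p (fun i => 𝔽.k (e i)))) ⊆ U := by
    rw [← realPrimePacket_O p 𝔽 j e]
    refine hB1.trans ?_
    have : B j e ⊆ (1 : (realPrimePacket p 𝔽).G₂ j e) • ((realPrimePacket p 𝔽).perm 1 e '' B j (e ∘ (1 : Equiv.Perm (Fin (j + 1))))) := by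
      rw [one_smul]
      intro x hx
      exact ⟨x, hx, (realPrimePacket p 𝔽).perm_one e x⟩
    exact this.trans (Set.subset_iUnion₂ (s := fun (g : (realPrimePacket p 𝔽).G₂ j e)
      (σ : Equiv.Perm (Fin (j + 1))) => g • ((realPrimePacket p 𝔽).perm σ e '' B j (e ∘ σ))) 1 1)
  have hsub : packetHull p (fun i => 𝔽.k (e i)) U ⊆ (normalizedPacket p (fun i => 𝔽.k (e i)) : Set (PacketAlgebra p (fun i => 𝔽.k (e i)))) :=
    (packetHull_mono p (fun i => 𝔽.k (e i)) hUu).trans hH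
  have hadm : PacketAdm p (fun i => 𝔽.k (e i)) (packetHull p (fun i => 𝔽.k (e i)) U) :=
    packetAdm_of_subset_of_subset p (fun i => 𝔽.k (e i)) (packetAdm_normalizedPacket p (fun i => 𝔽.k (e i))) (packetAdm_normalizedPacket p (fun i => 𝔽.k (e i)))
      (hUl.trans (subset_packetHull p (fun i => 𝔽.k (e i)) U)) hsub
  refine ⟨hadm, ?_⟩
  rw [← packetLogμ_normalizedPacket p (fun i => 𝔽.k (e i))]
  exact packetLogμ_mono p (fun i => 𝔽.k (e i)) hadm (packetAdm_normalizedPacket p (fun i => 𝔽.k (e i))) hsub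

end RealPacket

end Literature.IUT.LogVolume

end
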